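import Summits.HodgeConjecture.HodgeConjecture.Theorems.K2LiuRankOneCartanAnyPlace          -- ★ (hLiu418 estate) `isCartanFamily_unitaryInt_two`: `U₂ = ⨆ K₀ tʲ K₀` disjointly (rank-one Cartan, any place)
import Literature.NumberTheory.Automorphic.HermitianLatticeTreeFixedDictionary              -- ★ the N = 2 TREE MODEL: `latticeTree`, `latticeTreeIso`, `isTree_latticeTree`, (T3) `mk_eq_mk_iff_latt_eq`, `latticeTreeIso_apply_eq_self_iff`
import Literature.NumberTheory.Automorphic.HermitianLatticeTreeApartment                    -- ★ the apartment: `latt_diagonal_zpow_eq_iff ∕ _le_iff`, `scaleLattice_uniformizer_…`, `isSelfDualLattice_latt_diagonal_zpow`, `mapGL_latt_diagonal_zpow_of_coe_eq_translation`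
import Literature.NumberTheory.Automorphic.ValuedFieldValuativeRelBridge                    -- ★ `isUniformizingElement_of_v_eq`, `v_eq_iff_valuation_eq`, `isDiscreteValuationRing_integer_of_compatible` (`Valued` ↔ `ValuativeRel`)
import Literature.NumberTheory.Automorphic.UnitaryFixedCosetsStableLattices                 -- ★ `unitaryInt_eq_glInt_subgroupOf` (`K₀ = unitaryInt = GL₂(𝒪) ⊓ U`)
import Literature.NumberTheory.Automorphic.UnitaryTwoCartanAnyInvolution                     -- ★ `UnitaryGroup.Two.antidiagonal_two_over_eq` (`(StdForm.antidiagonal 2).over K = !![0,1;1,0]`)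
import Literature.Combinatorics.SimpleGraph.TreeDisplacementLayerCount                      -- ★ `TreeDisplacement.dist_eq_length_of_isPath`, `finite_setOf_dist_self_apply_eq'`
import Literature.Combinatorics.SimpleGraph.TreeDescendantPartition                         -- ★ `TreeLayers.dist_iso_apply` (graph isomorphisms are isometries)
import HarnessLib

/-!
# R90 · S6 «Ch. 14.1–14.5 stable trace formula» — CARD A1-H, FILE 1 (rows E1.3.5.2.5 ∕ E1.3.7.1): THE RANK-ONE DICTIONARY «SPHERES = CARTAN DOUBLE COSETS» ON THE
# BRUHAT–TITS TREE OF `U(2)_w ≅ U(1,1)` — `g ∈ K₀ tᵏ K₀ ↔ d(𝒪², g·𝒪²) = 2k` (`Theorems/R90S6ShellSphereDictU2.lean`)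

Dealer R90-C14-plan (g2), CARD A1-H 2026-09-05T00:48:01Z, ruling 00:50:12Z («the N = 2 tree model is ★ `HermitianLatticeTree*`»), junction census 00:56:18Z.  The rank-one twin of ★ W7-i
`R90S6CartanShellSphere` §1–§2 + ★ W8-d `R90S6ShellSphereDictU3` over the ★ `HermitianLatticeTree` model.  SETTING (both valuation currencies on ONE field, as on `w.adicCompletion L`):
`K : Type` a field with `Valued K ℤᵐ⁰` AND Mathlib's `ValuativeRel K`, `Valued.v` compatible; the cell's unramified datum `hd : UnramifiedLocalConjDatum σ ϖ` (`σ` an isometric involution,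
`σϖ = ϖ`, `v ϖ = exp(−1)`); `H₂ := (StdForm.antidiagonal 2).over K` (`= !![0,1;1,0]`, §1), `U₂ = U(σ, H₂)(K) = unitaryGroupOfForm σ H₂`, `K₀ = unitaryInt σ H₂ = GL₂(𝒪) ⊓ U₂`
(★ `unitaryInt_eq_glInt_subgroupOf`), `t ∈ U₂` with matrix `diag(ϖ, ϖ⁻¹)` (p03's binder `ht : ↑t = zpowDiagGL … ![1, −1]`, ★ `R90S6MacdonaldRankOneU2`); `X₂ = latticeTree σ ϖ H₂` the ★ tree of
self-dual and `ϖ`-modular lattices of the hermitian plane (★ `isTree_latticeTree`; at an inert place the Bruhat–Tits tree of `U(1,1)_w`, both valencies `q_v + 1`), root `x₀` with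
`x₀.1 = latt 1 = 𝒪²` (any such vertex term), `U₂` acting by ★ `latticeTreeIso`.

* §0 (generic graphs) **`dist_eq_of_adj_chain`**: an injective chain of adjacent vertices in a tree realises the distance (★ `TreeDisplacement.dist_eq_length_of_isPath`).
* §1 JUNCTION (`H₂ = !![0,1;1,0]` is ★ `UnitaryGroup.Two.antidiagonal_two_over_eq`): `isUnimodular₂_antidiagonal_two`, `valuation_map_eq_of_datum` (`hσv` from `hd.vσ`), `coe_eq_diagonal_of_coe_eq_zpowDiagGL`
  (`↑t = diag(ϖ, (σϖ)⁻¹)`, the apartment's translation letter), `coe_pow_eq_diagonal` (the Cartan family letters `↑(tʲ) = diag(ϖʲ, (σϖʲ)⁻¹)`).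
* §2 TREE GEOMETRY: `latticeTreeIso_mul_apply`, `dist_latticeTreeIso_latticeTreeIso_mul_eq` (transport of the displacement to the root), `latt_coe_eq_latt_coe_iff` (the coset bridge
  `latt ↑u = latt ↑u′ ↔ uK₀ = u′K₀` for `K₀ = unitaryInt`), **`latticeTreeIso_apply_eq_root_iff`** (`k·x₀ = x₀ ↔ k ∈ K₀`), `coe_latticeTreeIso_pow_root` (`tᵏ·x₀ = latt diag(ϖᵏ, ϖ⁻ᵏ)`),
  **`dist_root_latticeTreeIso_pow_root`** (`d(x₀, tᵏ·x₀) = 2k` — the apartment ray is a geodesic), `finite_selfDual_displaced_of_finite_fixedPoints_two`, `typeFun_ne_of_adj_two`.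
* §3 THE DICTIONARY **`mem_doubleCoset_pow_iff_dist_eq_two`**: `g ∈ K₀ tᵏ K₀ ↔ d(x₀, g·x₀) = 2k` ((→) isometry + stabiliser, (←) ★ Cartan cover `isCartanFamily_unitaryInt_two`).

FILE 2 `Theorems/R90S6EllipticOrbitalDisplacementU2.lean` turns §3 into the (J2)-twin `#shell = #displaced` and the orbital-integral assembly.
Cell `hodgecm-mathlib`, crux H413 (`stmt-HodgeConjecture-24833`), route of record `HCCMUnconditional`; programme R90-TF (brief `director/R90-BRIEF.v2.md` 1f40d54518340a35),
section S6 (base `R90-C14`), seat R90-C14-p01 (g2).  Lane `--kind proof --supports stmt-HodgeConjecture-24833 --as helper`; THEOREMS ONLY (no definition, no instance, no notation,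
no named fact, no kit, no `sorry`); `K : Type` (universe of ★ `isCartanFamily_unitaryInt_two`).
HONEST LABEL: lattice-model bookkeeping for the H-side engine E1.3.5.2.5 — count-neutral until E1.3.5.2.6 ∕ E1.3.7.1 consume it; proves no printed global statement, discharges no
citation; HC_CM is proved only modulo the 7 printed citations (2 remaining named inputs: hLiu418 = stmt-HodgeConjecture-24832, h413 = stmt-HodgeConjecture-24833) until rung 0 closes.

## References
* [BruhatTits1972] F. Bruhat, J. Tits, *Groupes réductifs sur un corps local I*, Publ. Math. IHÉS 41 (1972): §10, (4.4.3) (rank one: the building is a tree; Cartan decomposition).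
* [Serre1980Trees] J.-P. Serre, *Trees* (1980): I.6.4, II.1.1 (the tree of a rank-one group over a local field; apartments, stabilisers, distance from the base lattice).
* [Jacobowitz1962] R. Jacobowitz, *Hermitian forms over local fields*, Amer. J. Math. 84 (1962): §4, §7 (unimodular hermitian lattices).
* [Kottwitz1986BaseChangeUnits] R. E. Kottwitz, *Base change for unit elements of Hecke algebras*, Compositio Math. 60 (1986): §1 pp. 240–242 (cosets ↔ lattices).
* [Rogawski1990] J. D. Rogawski, *Automorphic Representations of Unitary Groups in Three Variables*, Ann. of Math. Stud. 123 (1990): §4.9 pp. 54–55, §4.11 pp. 59–60.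
-/

set_option autoImplicit false
-- the mandated namespace repeats the single-problem summit's segment (`HodgeConjecture.HodgeConjecture`)
set_option linter.dupNamespace false

noncomputable section

open Set Function
open scoped Pointwise ValuativeRel Matrix MatrixGroups
open MulAction SimpleGraph Matrix ValuativeRel
open Literature.NumberTheory.Automorphic
open Literature.NumberTheory.Automorphic.HermitianLatticeTree
open Literature.Combinatorics.SimpleGraph
open Summit.HodgeConjecture.HodgeConjecture.Cruxes.HLiu418.K2LiuRankOneCartanAnyPlace (isCartanFamily_unitaryInt_two)

namespace Summit.HodgeConjecture.HodgeConjecture.R90.S6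

/-! ## §0 Generic: an injective chain of adjacent vertices in a tree realises the distance -/

section Chain

variable {V : Type*} {G : SimpleGraph V}

/-- In a tree, if `A : ℕ → V` is injective with `A n ~ A (n+1)` for all `n`, then `d(A 0, A n) = n` (the chain is a path, and paths in trees are geodesics,
★ `TreeDisplacement.dist_eq_length_of_isPath`). [cite: Serre1980Trees, I.6.4, II.1.1] -/
theorem dist_eq_of_adj_chain (hT : G.IsTree) (A : ℕ → V) (hadj : ∀ n, G.Adj (A n) (A (n + 1))) (hinj : Function.Injective A) (n : ℕ) :
    G.dist (A 0) (A n) = n := by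
  -- a path of length `n` from `A 0` to `A n` supported on `A 0, …, A n`
  have key : ∀ n, ∃ p : G.Walk (A 0) (A n), p.IsPath ∧ p.length = n ∧ ∀ v ∈ p.support, ∃ m ≤ n, A m = v := by
    intro n
    induction n with
    | zero =>
      refine ⟨SimpleGraph.Walk.nil, SimpleGraph.Walk.IsPath.nil, rfl, fun v hv => ⟨0, le_rfl, ?_⟩⟩
      rw [SimpleGraph.Walk.support_nil, List.mem_singleton] at hv
      exact hv.symm
    | succ n ih =>
      obtain ⟨p, hp, hlen, hsupp⟩ := ih
      have hnot : A (n + 1) ∉ p.support := by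
        intro hmem
        obtain ⟨m, hm, hAm⟩ := hsupp _ hmem
        have := hinj hAm
        omega
      refine ⟨p.concat (hadj n), hp.concat hnot (hadj n), by rw [SimpleGraph.Walk.length_concat, hlen], fun v hv => ?_⟩
      rw [SimpleGraph.Walk.support_concat, List.mem_append, List.mem_singleton] at hv
      rcases hv with hv | hv
      · obtain ⟨m, hm, hAm⟩ := hsupp v hv
        exact ⟨m, by omega, hAm⟩
      · exact ⟨n + 1, le_rfl, hv.symm⟩
  obtain ⟨p, hp, hlen, -⟩ := key n
  rw [TreeDisplacement.dist_eq_length_of_isPath hT hp, hlen]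

end Chain

section Two

variable {K : Type} [Field K] [Valued K (WithZero (Multiplicative ℤ))] [ValuativeRel K]
  [(Valued.v : Valuation K (WithZero (Multiplicative ℤ))).Compatible] {σ : K →+* K} {ϖ : K}

/-! ## §1 Junction: `H₂ = antidiag(1,1)`, unimodular; the datum's letters in the `ValuativeRel` currency; the matrix of `t` and of `tʲ` -/

omit [Valued K (WithZero (Multiplicative ℤ))] [(Valued.v : Valuation K (WithZero (Multiplicative ℤ))).Compatible] in
/-- `H₂ = antidiag(1,1)` is unimodular (integral entries, `det = −1`). [cite: Jacobowitz1962, §7] [cite: BruhatTits1972, §10] -/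
theorem isUnimodular₂_antidiagonal_two : IsUnimodular₂ ((StdForm.antidiagonal 2).over K) := by
  rw [UnitaryGroup.Two.antidiagonal_two_over_eq]
  refine ⟨fun i j => ?_, ?_⟩
  · fin_cases i <;> fin_cases j <;> simp
  · simp [Matrix.det_fin_two]

/-- The datum's isometry letter in the `ValuativeRel` currency: `valuation (σ x) = valuation x` (★ `v_eq_iff_valuation_eq`). [cite: Jacobowitz1962, §4] -/
theorem valuation_map_eq_of_datum (hd : HermitianLattice.UnramifiedLocalConjDatum σ ϖ) (x : K) :
    valuation K (σ x) = valuation K x :=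
  (v_eq_iff_valuation_eq (σ x) x).1 (hd.vσ x)

omit [ValuativeRel K] [(Valued.v : Valuation K (WithZero (Multiplicative ℤ))).Compatible] in
/-- p03's torus binder read as the apartment's translation letter: `↑t = zpowDiagGL ![1, −1] ⇒ ↑t = diag(ϖ, (σϖ)⁻¹)` (`σϖ = ϖ` at an inert place).
[cite: BruhatTits1972, (4.4.3)] [cite: Serre1980Trees, II.1.1] -/
theorem coe_eq_diagonal_of_coe_eq_zpowDiagGL (hd : HermitianLattice.UnramifiedLocalConjDatum σ ϖ)
    (t : unitaryGroupOfForm σ ((StdForm.antidiagonal 2).over K))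
    (ht : (t : GL (Fin 2) K) = zpowDiagGL (CartanUnique.uniformizer_ne_zero hd.vϖ) ![(1 : ℤ), -1]) :
    ((t : GL (Fin 2) K) : Matrix (Fin 2) (Fin 2) K) = Matrix.diagonal ![ϖ, (σ ϖ)⁻¹] := by
  rw [ht, coe_zpowDiagGL, hd.σϖ]
  congr 1
  funext i
  fin_cases i
  · simp
  · simp

omit [ValuativeRel K] [(Valued.v : Valuation K (WithZero (Multiplicative ℤ))).Compatible] in
/-- The Cartan family letters: `↑(tʲ) = diag(ϖʲ, (σ ϖʲ)⁻¹)` for every `j ∈ ℕ` (the `hb` of ★ `isCartanFamily_unitaryInt_two`). [cite: BruhatTits1972, (4.4.3)] -/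
theorem coe_pow_eq_diagonal (hd : HermitianLattice.UnramifiedLocalConjDatum σ ϖ)
    (t : unitaryGroupOfForm σ ((StdForm.antidiagonal 2).over K))
    (ht : (t : GL (Fin 2) K) = zpowDiagGL (CartanUnique.uniformizer_ne_zero hd.vϖ) ![(1 : ℤ), -1]) (j : ℕ) :
    (((t ^ j : unitaryGroupOfForm σ ((StdForm.antidiagonal 2).over K)) : GL (Fin 2) K) : Matrix (Fin 2) (Fin 2) K) =
      Matrix.diagonal ![ϖ ^ j, (σ (ϖ ^ j))⁻¹] := by
  rw [SubgroupClass.coe_pow, Units.val_pow_eq_pow_val, coe_eq_diagonal_of_coe_eq_zpowDiagGL hd t ht, Matrix.diagonal_pow, map_pow, hd.σϖ]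
  congr 1
  funext i
  fin_cases i
  · simp
  · simp [inv_pow]

/-! ## §2 Tree geometry at `H₂`: the action, the stabiliser of the root, the apartment ray and its distances -/

omit [Valued K (WithZero (Multiplicative ℤ))] [(Valued.v : Valuation K (WithZero (Multiplicative ℤ))).Compatible] in
/-- The action is multiplicative on vertices: `(u u′)·x = u·(u′·x)` (★ `mapGL_mul`). [cite: BruhatTits1972, §10] -/
theorem latticeTreeIso_mul_apply {H : Matrix (Fin 2) (Fin 2) K} (u u' : unitaryGroupOfForm σ H)
    (x : {M : Submodule 𝒪[K] (Fin 2 → K) // IsSpecialLattice σ ϖ H M}) :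
    latticeTreeIso σ ϖ H (u * u') x = latticeTreeIso σ ϖ H u (latticeTreeIso σ ϖ H u' x) := by
  apply Subtype.ext
  change mapGL ((u * u' : unitaryGroupOfForm σ H) : GL (Fin 2) K) x.1 = mapGL (u : GL (Fin 2) K) (mapGL (u' : GL (Fin 2) K) x.1)
  rw [Subgroup.coe_mul, mapGL_mul]

omit [Valued K (WithZero (Multiplicative ℤ))] [(Valued.v : Valuation K (WithZero (Multiplicative ℤ))).Compatible] in
/-- **Transport of the displacement to the root** (rank-one twin of ★ (J2) `dist_latticeGraphPerm_latticeGraphPerm_mul_eq`): `d(u·x, γ·(u·x)) = d(x, (u⁻¹γu)·x)`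
(`u` acts by an isometry, ★ `TreeLayers.dist_iso_apply`). [cite: Serre1980Trees, II.1.1] [cite: BruhatTits1972, §10] -/
theorem dist_latticeTreeIso_latticeTreeIso_mul_eq {H : Matrix (Fin 2) (Fin 2) K} (u γ : unitaryGroupOfForm σ H)
    (x : {M : Submodule 𝒪[K] (Fin 2 → K) // IsSpecialLattice σ ϖ H M}) :
    (latticeTree σ ϖ H).dist (latticeTreeIso σ ϖ H u x) (latticeTreeIso σ ϖ H γ (latticeTreeIso σ ϖ H u x)) =
      (latticeTree σ ϖ H).dist x (latticeTreeIso σ ϖ H (u⁻¹ * γ * u) x) := by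
  have h1 : latticeTreeIso σ ϖ H γ (latticeTreeIso σ ϖ H u x) = latticeTreeIso σ ϖ H u (latticeTreeIso σ ϖ H (u⁻¹ * γ * u) x) := by
    rw [← latticeTreeIso_mul_apply, ← latticeTreeIso_mul_apply, ← mul_assoc, ← mul_assoc, mul_inv_cancel, one_mul]
  rw [h1]
  exact TreeLayers.dist_iso_apply (latticeTreeIso σ ϖ H u) x _

/-- The coset bridge: `latt ↑u = latt ↑u′ ↔ u K₀ = u′ K₀` in `U ⧸ unitaryInt` (★ (T3) `mk_eq_mk_iff_latt_eq` for `GL₂(𝒪) ⊓ U`, ★ `unitaryInt_eq_glInt_subgroupOf`).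
[cite: Kottwitz1986BaseChangeUnits, §1 pp. 240–242] [cite: Serre1980Trees, II.1.1] -/
theorem latt_coe_eq_latt_coe_iff {H : Matrix (Fin 2) (Fin 2) K} (u u' : unitaryGroupOfForm σ H) :
    latt (((u : GL (Fin 2) K)) : Matrix (Fin 2) (Fin 2) K) = latt (((u' : GL (Fin 2) K)) : Matrix (Fin 2) (Fin 2) K) ↔
      (u : unitaryGroupOfForm σ H ⧸ HermitianLattice.unitaryInt σ H) = u' := by
  rw [← mk_eq_mk_iff_latt_eq σ u u', QuotientGroup.eq, QuotientGroup.eq, UnitaryLatticeTree.unitaryInt_eq_glInt_subgroupOf σ H]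

/-- **The stabiliser of the root is `K₀`**: for a vertex `x₀` with `x₀.1 = latt 1 = 𝒪²`, `k·x₀ = x₀ ↔ k ∈ unitaryInt σ H`.
[cite: Serre1980Trees, II.1.1] [cite: BruhatTits1972, §10] -/
theorem latticeTreeIso_apply_eq_root_iff {H : Matrix (Fin 2) (Fin 2) K} (k : unitaryGroupOfForm σ H)
    (x₀ : {M : Submodule 𝒪[K] (Fin 2 → K) // IsSpecialLattice σ ϖ H M}) (hx₀ : x₀.1 = latt (1 : Matrix (Fin 2) (Fin 2) K)) :
    latticeTreeIso σ ϖ H k x₀ = x₀ ↔ k ∈ HermitianLattice.unitaryInt σ H := by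
  have h1 : latt (1 : Matrix (Fin 2) (Fin 2) K) = latt ((((1 : unitaryGroupOfForm σ H) : GL (Fin 2) K)) : Matrix (Fin 2) (Fin 2) K) := by
    rw [Subgroup.coe_one, Units.val_one]
  rw [latticeTreeIso_apply_eq_self_iff, hx₀, h1, mapGL_coe_latt, mul_one, latt_coe_eq_latt_coe_iff, QuotientGroup.eq, mul_one, inv_mem_iff]

/-- Along the action of the translation `t` (`↑t = diag(ϖ, (σϖ)⁻¹)`): `(tᵏ·x₀).1 = latt diag(ϖᵏ, ϖ⁻ᵏ)` for the root `x₀ = 𝒪²`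
(★ `mapGL_latt_diagonal_zpow_of_coe_eq_translation`, iterated). [cite: Serre1980Trees, I.6.4, II.1.1] -/
theorem coe_latticeTreeIso_pow_root (hd : HermitianLattice.UnramifiedLocalConjDatum σ ϖ)
    (t : unitaryGroupOfForm σ ((StdForm.antidiagonal 2).over K))
    (ht : (t : GL (Fin 2) K) = zpowDiagGL (CartanUnique.uniformizer_ne_zero hd.vϖ) ![(1 : ℤ), -1])
    (x₀ : {M : Submodule 𝒪[K] (Fin 2 → K) // IsSpecialLattice σ ϖ ((StdForm.antidiagonal 2).over K) M})
    (hx₀ : x₀.1 = latt (1 : Matrix (Fin 2) (Fin 2) K)) (k : ℕ) :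
    (latticeTreeIso σ ϖ ((StdForm.antidiagonal 2).over K) (t ^ k) x₀).1 = latt (Matrix.diagonal ![ϖ ^ (k : ℤ), ϖ ^ (-(k : ℤ))]) := by
  have hϖ := isUniformizingElement_of_v_eq hd.vϖ
  have ht' := coe_eq_diagonal_of_coe_eq_zpowDiagGL hd t ht
  induction k with
  | zero =>
    rw [pow_zero]
    change mapGL ((1 : unitaryGroupOfForm σ ((StdForm.antidiagonal 2).over K)) : GL (Fin 2) K) x₀.1 = _
    rw [Subgroup.coe_one, mapGL_one, hx₀, latt_one_eq_latt_mul_diagonal_zero (ϖ := ϖ) 1 (Subgroup.one_mem _), Units.val_one, Matrix.one_mul,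
      Nat.cast_zero, neg_zero]
  | succ k ih =>
    rw [pow_succ', latticeTreeIso_mul_apply]
    change mapGL (t : GL (Fin 2) K) (latticeTreeIso σ ϖ ((StdForm.antidiagonal 2).over K) (t ^ k) x₀).1 = _
    rw [ih, mapGL_latt_diagonal_zpow_of_coe_eq_translation hϖ σ (valuation_map_eq_of_datum hd) ht', Nat.cast_succ, neg_add, ← sub_eq_add_neg]

/-- **`d(x₀, tᵏ·x₀) = 2k`**: the apartment ray `n ↦ latt diag(ϖ^⌈n∕2⌉, ϖ^{−⌊n∕2⌋})` from the root is an injective chain of adjacent vertices (self-dual for even `n`, `ϖ`-modular for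
odd `n`, ★ apartment lemmas transported along `H₂ = !![0,1;1,0]`), hence a geodesic of the tree (§0 on ★ `isTree_latticeTree`); its `2k`-th vertex is `tᵏ·x₀`.
[cite: Serre1980Trees, I.6.4, II.1.1] [cite: BruhatTits1972, §10] -/
theorem dist_root_latticeTreeIso_pow_root (hd : HermitianLattice.UnramifiedLocalConjDatum σ ϖ)
    (t : unitaryGroupOfForm σ ((StdForm.antidiagonal 2).over K))
    (ht : (t : GL (Fin 2) K) = zpowDiagGL (CartanUnique.uniformizer_ne_zero hd.vϖ) ![(1 : ℤ), -1])
    (x₀ : {M : Submodule 𝒪[K] (Fin 2 → K) // IsSpecialLattice σ ϖ ((StdForm.antidiagonal 2).over K) M})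
    (hx₀ : x₀.1 = latt (1 : Matrix (Fin 2) (Fin 2) K)) (k : ℕ) :
    (latticeTree σ ϖ ((StdForm.antidiagonal 2).over K)).dist x₀ (latticeTreeIso σ ϖ ((StdForm.antidiagonal 2).over K) (t ^ k) x₀) = 2 * k := by
  haveI := isDiscreteValuationRing_integer_of_compatible hd.vϖ
  have hϖ := isUniformizingElement_of_v_eq hd.vϖ
  have hσv := valuation_map_eq_of_datum hd
  have hJ : (StdForm.antidiagonal 2).over K = !![(0 : K), 1; 1, 0] := UnitaryGroup.Two.antidiagonal_two_over_eq
  -- the apartment ray: exponents `(⌈n∕2⌉, −⌊n∕2⌋)`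
  have hsd : ∀ n : ℕ, (n + 1) / 2 = n / 2 →
      IsSelfDualLattice σ ((StdForm.antidiagonal 2).over K) (latt (Matrix.diagonal ![ϖ ^ (((n + 1) / 2 : ℕ) : ℤ), ϖ ^ (-((n / 2 : ℕ) : ℤ))])) := by
    intro n hn
    rw [hJ]
    exact isSelfDualLattice_latt_diagonal_zpow σ hσv hϖ (by rw [hn]; ring)
  have hmod : ∀ n : ℕ, (n + 1) / 2 = n / 2 + 1 →
      IsModularLattice σ ϖ ((StdForm.antidiagonal 2).over K) (latt (Matrix.diagonal ![ϖ ^ (((n + 1) / 2 : ℕ) : ℤ), ϖ ^ (-((n / 2 : ℕ) : ℤ))])) := by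
    intro n hn
    rw [hJ]
    exact isModularLattice_latt_diagonal_zpow σ hσv hϖ (by rw [hn]; push_cast; ring)
  have hsp : ∀ n : ℕ, IsSpecialLattice σ ϖ ((StdForm.antidiagonal 2).over K) (latt (Matrix.diagonal ![ϖ ^ (((n + 1) / 2 : ℕ) : ℤ), ϖ ^ (-((n / 2 : ℕ) : ℤ))])) := by
    intro n
    rcases Nat.even_or_odd n with ⟨m, hm⟩ | ⟨m, hm⟩
    · exact Or.inl (hsd n (by omega))
    · exact Or.inr (hmod n (by omega))
  let A : ℕ → {M : Submodule 𝒪[K] (Fin 2 → K) // IsSpecialLattice σ ϖ ((StdForm.antidiagonal 2).over K) M} :=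
    fun n => ⟨latt (Matrix.diagonal ![ϖ ^ (((n + 1) / 2 : ℕ) : ℤ), ϖ ^ (-((n / 2 : ℕ) : ℤ))]), hsp n⟩
  have hA : ∀ n, (A n).1 = latt (Matrix.diagonal ![ϖ ^ (((n + 1) / 2 : ℕ) : ℤ), ϖ ^ (-((n / 2 : ℕ) : ℤ))]) := fun n => rfl
  -- injectivity: `n ↦ (⌈n∕2⌉, −⌊n∕2⌋)` is injective (`n = ⌈n∕2⌉ + ⌊n∕2⌋`)
  have hinj : Function.Injective A := by
    intro n n' h
    have h' := (latt_diagonal_zpow_eq_iff hϖ _ _ _ _).1 (congrArg Subtype.val h)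
    omega
  -- adjacency of consecutive vertices (the ★ apartment adjacency, re-derived at `H₂` from the generic `latticeTree_adj_iff`)
  have hadj : ∀ n, (latticeTree σ ϖ ((StdForm.antidiagonal 2).over K)).Adj (A n) (A (n + 1)) := by
    intro n
    have hne : A n ≠ A (n + 1) := fun h => by have := hinj h; omega
    rcases Nat.even_or_odd n with ⟨m, hm⟩ | ⟨m, hm⟩
    · -- `A n` self-dual `(m, −m)`, `A (n+1)` modular `(m+1, −m)`
      have h1 : (n + 1) / 2 = n / 2 := by omega
      have h2 : (n + 1 + 1) / 2 = (n + 1) / 2 + 1 := by omega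
      rw [latticeTree_adj_iff]
      refine ⟨hne, Or.inl ⟨hsd n h1, hmod (n + 1) h2, ?_, ?_⟩⟩
      · rw [hA, hA, scaleLattice_uniformizer_latt_diagonal_zpow hϖ, latt_diagonal_zpow_le_iff hϖ]
        constructor <;> push_cast <;> omega
      · rw [hA, hA, latt_diagonal_zpow_le_iff hϖ]
        constructor <;> push_cast <;> omega
    · -- `A n` modular `(m+1, −m)`, `A (n+1)` self-dual `(m+1, −(m+1))`
      have h1 : (n + 1) / 2 = n / 2 + 1 := by omega
      have h2 : (n + 1 + 1) / 2 = (n + 1) / 2 := by omega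
      rw [latticeTree_adj_iff]
      refine ⟨hne, Or.inr ⟨hsd (n + 1) h2, hmod n h1, ?_, ?_⟩⟩
      · rw [hA, hA, scaleLattice_uniformizer_latt_diagonal_zpow hϖ, latt_diagonal_zpow_le_iff hϖ]
        constructor <;> push_cast <;> omega
      · rw [hA, hA, latt_diagonal_zpow_le_iff hϖ]
        constructor <;> push_cast <;> omega
  -- `A 0 = x₀` and `A (2k) = tᵏ·x₀`
  have h0 : A 0 = x₀ := by
    apply Subtype.ext
    rw [hA, hx₀, latt_one_eq_latt_mul_diagonal_zero (ϖ := ϖ) 1 (Subgroup.one_mem _), Units.val_one, Matrix.one_mul]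
    norm_num
  have h2k : A (2 * k) = latticeTreeIso σ ϖ ((StdForm.antidiagonal 2).over K) (t ^ k) x₀ := by
    apply Subtype.ext
    rw [hA, coe_latticeTreeIso_pow_root hd t ht x₀ hx₀ k, show ((2 * k + 1) / 2 : ℕ) = k by omega, show (2 * k / 2 : ℕ) = k by omega]
  rw [← h2k, ← h0]
  exact dist_eq_of_adj_chain (isTree_latticeTree σ hσv hϖ isUnimodular₂_antidiagonal_two) A hadj hinj (2 * k)

/-! ## §3 The rank-one W8-d dictionary: `g ∈ K₀ tᵏ K₀ ↔ d(x₀, g·x₀) = 2k` -/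

/-- **SPHERES = CARTAN DOUBLE COSETS, rank one**: for `g ∈ U₂` and `k ∈ ℕ`, `g ∈ K₀ tᵏ K₀ ↔ d(x₀, g·x₀) = 2k` in the lattice tree (`x₀ = 𝒪²`).  (→) `g = k₁ tᵏ k₂`: `k₂` fixes
the root, `k₁` is an isometry fixing the root, so `d(x₀, g·x₀) = d(x₀, tᵏ·x₀) = 2k` (§2); (←) by the ★ rank-one Cartan COVER `g ∈ K₀ tʲ K₀` for some `j` (★ `isCartanFamily_unitaryInt_two`)
and then `2j = 2k`. [cite: BruhatTits1972, §10, (4.4.3)] [cite: Serre1980Trees, II.1.1] -/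
theorem mem_doubleCoset_pow_iff_dist_eq_two (hd : HermitianLattice.UnramifiedLocalConjDatum σ ϖ)
    (t : unitaryGroupOfForm σ ((StdForm.antidiagonal 2).over K))
    (ht : (t : GL (Fin 2) K) = zpowDiagGL (CartanUnique.uniformizer_ne_zero hd.vϖ) ![(1 : ℤ), -1])
    (x₀ : {M : Submodule 𝒪[K] (Fin 2 → K) // IsSpecialLattice σ ϖ ((StdForm.antidiagonal 2).over K) M})
    (hx₀ : x₀.1 = latt (1 : Matrix (Fin 2) (Fin 2) K)) (g : unitaryGroupOfForm σ ((StdForm.antidiagonal 2).over K)) (k : ℕ) :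
    g ∈ DoubleCoset.doubleCoset (t ^ k) (HermitianLattice.unitaryInt σ ((StdForm.antidiagonal 2).over K) : Set _)
        (HermitianLattice.unitaryInt σ ((StdForm.antidiagonal 2).over K)) ↔
      (latticeTree σ ϖ ((StdForm.antidiagonal 2).over K)).dist x₀ (latticeTreeIso σ ϖ ((StdForm.antidiagonal 2).over K) g x₀) = 2 * k := by
  -- (→) for every `j`
  have himp : ∀ (j : ℕ) (g : unitaryGroupOfForm σ ((StdForm.antidiagonal 2).over K)),
      g ∈ DoubleCoset.doubleCoset (t ^ j) (HermitianLattice.unitaryInt σ ((StdForm.antidiagonal 2).over K) : Set _)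
        (HermitianLattice.unitaryInt σ ((StdForm.antidiagonal 2).over K)) →
      (latticeTree σ ϖ ((StdForm.antidiagonal 2).over K)).dist x₀ (latticeTreeIso σ ϖ ((StdForm.antidiagonal 2).over K) g x₀) = 2 * j := by
    intro j g hg
    obtain ⟨k₁, hk₁, k₂, hk₂, rfl⟩ := DoubleCoset.mem_doubleCoset.1 hg
    have hk₂' : latticeTreeIso σ ϖ ((StdForm.antidiagonal 2).over K) k₂ x₀ = x₀ := (latticeTreeIso_apply_eq_root_iff k₂ x₀ hx₀).2 hk₂
    have hk₁' : latticeTreeIso σ ϖ ((StdForm.antidiagonal 2).over K) k₁ x₀ = x₀ := (latticeTreeIso_apply_eq_root_iff k₁ x₀ hx₀).2 hk₁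
    rw [latticeTreeIso_mul_apply, latticeTreeIso_mul_apply, hk₂']
    nth_rw 1 [← hk₁']
    rw [TreeLayers.dist_iso_apply (latticeTreeIso σ ϖ ((StdForm.antidiagonal 2).over K) k₁)]
    exact dist_root_latticeTreeIso_pow_root hd t ht x₀ hx₀ j
  refine ⟨himp k g, fun hdist => ?_⟩
  -- (←) Cartan cover
  obtain ⟨j, hj⟩ := (isCartanFamily_unitaryInt_two hd.σσ hd.vσ hd.vϖ (fun j => t ^ j) (coe_pow_eq_diagonal hd t ht)).1 g
  have h2 : 2 * j = 2 * k := (himp j g hj).symm.trans hdist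
  obtain rfl : j = k := by omega
  exact hj

omit [Valued K (WithZero (Multiplicative ℤ))] [(Valued.v : Valuation K (WithZero (Multiplicative ℤ))).Compatible] in
/-- **Elliptic finiteness** (rank one): a fixed vertex, finite fixed set and local finiteness give finitely many self-dual vertices displaced by `2k`, for every `k`
(★ `TreeDisplacement.finite_setOf_dist_self_apply_eq'` on ★ `isTree_latticeTree`). [cite: Serre1980Trees, I.6.4 Prop. 24] -/
theorem finite_selfDual_displaced_of_finite_fixedPoints_two {H : Matrix (Fin 2) (Fin 2) K} (hT : (latticeTree σ ϖ H).IsTree)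
    (γ : unitaryGroupOfForm σ H) (hloc : ∀ v, ((latticeTree σ ϖ H).neighborSet v).Finite)
    {u : {M : Submodule 𝒪[K] (Fin 2 → K) // IsSpecialLattice σ ϖ H M}} (hu : latticeTreeIso σ ϖ H γ u = u)
    (hfix : {v | latticeTreeIso σ ϖ H γ v = v}.Finite) (k : ℕ) :
    {x : {M : Submodule 𝒪[K] (Fin 2 → K) // IsSpecialLattice σ ϖ H M} |
        IsSelfDualLattice σ H x.1 ∧ (latticeTree σ ϖ H).dist x (latticeTreeIso σ ϖ H γ x) = 2 * k}.Finite :=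
  (TreeDisplacement.finite_setOf_dist_self_apply_eq' hT (latticeTreeIso σ ϖ H γ) hu hfix hloc k).subset fun _ hx => hx.2

/-- On the rank-one tree a type function (`c v = 0 ↔ v` self-dual) takes different values at adjacent vertices (an edge joins a self-dual and a `ϖ`-modular lattice, and no lattice
is both, ★ `not_isModularLattice_of_isSelfDualLattice`). [cite: BruhatTits1972, §10] [cite: Serre1980Trees, II.1.1] -/
theorem typeFun_ne_of_adj_two (hd : HermitianLattice.UnramifiedLocalConjDatum σ ϖ)
    (c : {M : Submodule 𝒪[K] (Fin 2 → K) // IsSpecialLattice σ ϖ ((StdForm.antidiagonal 2).over K) M} → Fin 2)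
    (hc0 : ∀ v, c v = 0 ↔ IsSelfDualLattice σ ((StdForm.antidiagonal 2).over K) v.1) :
    ∀ v w, (latticeTree σ ϖ ((StdForm.antidiagonal 2).over K)).Adj v w → c v ≠ c w := by
  have hσv := valuation_map_eq_of_datum hd
  have hϖ := isUniformizingElement_of_v_eq hd.vϖ
  intro v w h hEq
  rcases (latticeTree_adj_iff σ ϖ _ v w).1 h with ⟨-, ⟨hv, hw, -, -⟩ | ⟨hw, hv, -, -⟩⟩
  · have hcw : c w = 0 := hEq ▸ (hc0 v).2 hv
    exact not_isModularLattice_of_isSelfDualLattice σ hσv hϖ _ ((hc0 w).1 hcw) hw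
  · have hcv : c v = 0 := hEq.symm ▸ (hc0 w).2 hw
    exact not_isModularLattice_of_isSelfDualLattice σ hσv hϖ _ ((hc0 v).1 hcv) hv

end Two

end Summit.HodgeConjecture.HodgeConjecture.R90.S6

end
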